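import Mathlib
import HarnessLib
import Summits.HubbardSuperconductivity.HubbardSuperconductivity.Theorems.KLProgrammeKLRegimeTwoVolumeDualRowsFrameSplit
import Summits.HubbardSuperconductivity.HubbardSuperconductivity.Theorems.KLProgrammeKLRegimeTwoVolumeFrameConversionRows
import Summits.HubbardSuperconductivity.HubbardSuperconductivity.Theorems.KLProgrammeKLRegimeTwoVolumeFrameChainRows

/-!
# Route `KLProgramme` — crux K3 ENGINE (stmt-HubbardSuperconductivity-20437 `KLRegimeEngineV17F2`), stub (e) proof-input «(e)-D-ROWS», keying (A′) (pen (R495)):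
# THE CONVERSION ROWS `Pe` OF THE SPATIAL DUAL ROW AT THE VL READING SCALE `n′ = nScales β + 1`, from three NAMED `ℓ¹` data and one raw row sup
# (cell gate-hubbard-kl, seat hubbard-kl-k3c4-p1 g26, VL lane; memo DROWS-SCOPE-g26.md §14; assembles p732040 + p732740 + `…TwoVolumeFrameChainRows`)

At the last scale the frame conversion of `T(K) − 𝒩_K` on the fine volume is EXACT (`…DualRowsFrameSplit.klEffectiveAction_sub_counterQuadratic_frame_eq_lastScale`):
conversion element `= (effAction_{Ψ_{K₂}}(𝒩_D) − 𝒩_D) + (S_m·T(K₁) − T(K₁))`.  Its lifted pinned raw two-leg rows at the fine pin `of` (both offset signs — the `hPe` input of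
`…DualRowsFrameSplit.hPd_of_commonFrame_add_conversion`) are therefore at most twice (`…FrameConversionRows.sum_lifted_offsets_le_two_mul`, `L₁ ≤ L₂`) the sum of
(i) the `ℓ¹` character sum of the chain symbol (`…FrameChainRows.pinnedRow_two_chain_eq`, named `Xχ`), and (ii) the dressing rows (`…FrameConversionRows.fixedTupleL1_dress_sub_le`:
`(Rδ·Cv + Cδ)·S/ε` from the `ε`-normalised pin row `Rδ` / column sums `Cv`, `Cδ` of the overlap kernels of `m − 1`, `m`, `m − 1` and the sup `S` of the `ε`-weighted pinned raw
two-leg rows of the fine volume's action AT THE COARSE FRAME `T^{L₂}(K₁)`):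

* **`hPe_lastScale_le`** — the `hPe` rows `≤ 2·Xχ + 2·(Rδ·Cv + Cδ)·S/ε` per spin;
* **`hdualSp_point_lastScale_of_commonFrame`** — composed with p732040: the body of `hdualSp` at `n′ = nScales β + 1` from the COMMON-FRAME pinned defect `Pc`, the far rows
  `Pf`, and the four named data (`ε·(Pc σ + Pe) ≤ Dd/L₁`, `ε·Pf σ ≤ Df/L₁`).

Pure composition; the named data are hypotheses (their estimates: next file, with the «VL-RESUM-WINDOW» smallness); nothing asserts the (D) rows, (e), VL, K3 or superconductivity.
References: BGM 2006 §2.3 (2.21)–(2.24), §2.4 (2.38) [cite: BenfattoGiulianiMastropietro2006]; Feldman–Salmhofer–Trubowitz 1996 §1.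
-/

noncomputable section

namespace Summit.HubbardSuperconductivity.HubbardSuperconductivity.Theorems.TwoVolumeDefect

set_option linter.dupNamespace false -- summit = problem name (single-conjunct summit), D-0017

open Finset Complex Literature.MathematicalPhysics.QuantumLattice Literature.Probability.LatticeModels GrassmannAlgebra
open Summit.HubbardSuperconductivity.HubbardSuperconductivity.Theorems.KLRegimeSplit
open Summit.HubbardSuperconductivity.HubbardSuperconductivity.Theorems.KLProgrammeLegKernels

variable {L₁ L₂ M₂ : ℕ} [NeZero L₁] [NeZero L₂] [NeZero M₂]

omit [NeZero M₂] in
/-- The resummation dressing `m(X) = (1 + Ψ_{K₂}(X.1)·κ_D(X.1))⁻¹` is a function of the MOMENTUM label only (`uvSymbolCT` does not read the spin). -/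
theorem dress_weight_momentum (β μ : ℝ) (K₂ K₁ : TrigPolyC4v) (Λ : ℝ) (X : HubbardFieldIdx L₂ M₂) :
    (1 + uvSymbolCT L₂ M₂ β μ K₂ Λ X.1 * (((fsub K₂ K₁).eval (latticeMomentum L₂ X.1.1.2) / (β * (L₂ : ℝ) ^ 2) : ℝ) : ℂ))⁻¹ =
      (fun k : FreqMomentum L₂ M₂ => (1 + uvSymbolCT L₂ M₂ β μ K₂ Λ (k, 0) *
        (((fsub K₂ K₁).eval (latticeMomentum L₂ k.2) / (β * (L₂ : ℝ) ^ 2) : ℝ) : ℂ))⁻¹) X.1.1 := by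
  obtain ⟨⟨k, s⟩, c⟩ := X
  simp only [uvSymbolCT]

/-- **THE CONVERSION ROWS `Pe` AT THE LAST SCALE.**  Fine volume `L₂`, coarse `L₁ ≤ L₂`, `0 < β`, `n′ = nScales β + 1`, frames `K₁ = klFlowFrameU L₁ M₂ … n′` (coarse),
`K₂ = klFlowFrameU L₂ M₂ … n′` (fine), `D = K₂ ⊖ K₁`, `m = (1 + Ψ_{K₂}κ_D)⁻¹`, the frame-`K₁` partition function of the fine volume a unit.  Named data (uniform in the spin):
`Xχ ≥` the `ℓ¹` character sum of the chain symbol at the pin (`pinnedRow_two_chain_eq`'s right side), `Rδ/ε ≥` the pin row of the overlap kernel of `m − 1` at `of`,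
`Cv/ε`, `Cδ/ε ≥` the column sums of the overlap kernels of `m`, `m − 1`, `S ≥` the `ε`-weighted pinned raw two-leg rows of `T^{L₂}(K₁)`.  Then the `hPe` rows of
`hPd_of_commonFrame_add_conversion` are `≤ 2·Xχ + 2·((Rδ·Cv + Cδ)·S/ε)`. [cite: BenfattoGiulianiMastropietro2006, §2.3 (2.21)–(2.24)] -/
theorem hPe_lastScale_le (hL : L₁ ≤ L₂) {β : ℝ} (hβ : 0 < β) (U μ : ℝ) (of : SpaceTimeIdx L₂ M₂)
    (hZ₁ : IsUnit (effPartitionFn ℂ (normalCovariance L₂ M₂ (uvSymbolCT L₂ M₂ β μ (klFlowFrameU L₁ M₂ β U μ (nScales β + 1)) (klScale klE0 (nScales β + 1))))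
      (hubbardInteraction L₂ M₂ β U + counterQuadratic L₂ M₂ β (klFlowFrameU L₁ M₂ β U μ (nScales β + 1)))))
    {Xχ Rδ Cv Cδ S : ℝ} (hCv0 : 0 ≤ Cv) (hCδ0 : 0 ≤ Cδ) (hS0 : 0 ≤ S)
    (hχ : ∀ σ : Fin 2, ∑ x₁ : SpaceTimeIdx L₂ M₂, ‖∑ k : FreqMomentum L₂ M₂,
        ((((fsub (klFlowFrameU L₂ M₂ β U μ (nScales β + 1)) (klFlowFrameU L₁ M₂ β U μ (nScales β + 1))).eval (latticeMomentum L₂ k.2) /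
                (β * (L₂ : ℝ) ^ 2) : ℝ) : ℂ) /
              (1 + uvSymbolCT L₂ M₂ β μ (klFlowFrameU L₂ M₂ β U μ (nScales β + 1)) (klScale klE0 (nScales β + 1)) (k, σ) *
                (((fsub (klFlowFrameU L₂ M₂ β U μ (nScales β + 1)) (klFlowFrameU L₁ M₂ β U μ (nScales β + 1))).eval (latticeMomentum L₂ k.2) /
                  (β * (L₂ : ℝ) ^ 2) : ℝ) : ℂ)) -
            (((fsub (klFlowFrameU L₂ M₂ β U μ (nScales β + 1)) (klFlowFrameU L₁ M₂ β U μ (nScales β + 1))).eval (latticeMomentum L₂ k.2) /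
              (β * (L₂ : ℝ) ^ 2) : ℝ) : ℂ)) * (((2 : ℕ).factorial : ℚ)⁻¹ • (1 : ℂ)) *
          (Complex.exp (((matsubaraFreq β M₂ k.1 * (imagTime β M₂ x₁.1 - imagTime β M₂ of.1) : ℝ) : ℂ) * I) * torusChar k.2 (x₁.2 - of.2))‖ ≤ Xχ)
    (hRδ : ∀ σ : Fin 2, ∑ y : SpaceTimeIdx L₂ M₂,
      ‖(sectorAnalysisMatrix L₂ M₂ β (![fun _ => 1,
          fun k => (1 + uvSymbolCT L₂ M₂ β μ (klFlowFrameU L₂ M₂ β U μ (nScales β + 1)) (klScale klE0 (nScales β + 1)) (k, 0) *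
            (((fsub (klFlowFrameU L₂ M₂ β U μ (nScales β + 1)) (klFlowFrameU L₁ M₂ β U μ (nScales β + 1))).eval (latticeMomentum L₂ k.2) /
              (β * (L₂ : ℝ) ^ 2) : ℝ) : ℂ))⁻¹ - 1,
          fun k => (1 + uvSymbolCT L₂ M₂ β μ (klFlowFrameU L₂ M₂ β U μ (nScales β + 1)) (klScale klE0 (nScales β + 1)) (k, 0) *
            (((fsub (klFlowFrameU L₂ M₂ β U μ (nScales β + 1)) (klFlowFrameU L₁ M₂ β U μ (nScales β + 1))).eval (latticeMomentum L₂ k.2) /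
              (β * (L₂ : ℝ) ^ 2) : ℝ) : ℂ))⁻¹] : Fin 3 → FreqMomentum L₂ M₂ → ℂ) *
          sectorSubMatrix L₂ M₂ β (trivialMultiplier L₂ M₂)) (of, (((1 : Fin 3), σ), 0)) (y, (((0 : Fin 1), σ), 0))‖ ≤ Rδ / imagTimeWeight β M₂)
    (hCv : ∀ (σ : Fin 2) (y : SpaceTimeIdx L₂ M₂), ∑ x : SpaceTimeIdx L₂ M₂,
      ‖(sectorAnalysisMatrix L₂ M₂ β (![fun _ => 1,
          fun k => (1 + uvSymbolCT L₂ M₂ β μ (klFlowFrameU L₂ M₂ β U μ (nScales β + 1)) (klScale klE0 (nScales β + 1)) (k, 0) *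
            (((fsub (klFlowFrameU L₂ M₂ β U μ (nScales β + 1)) (klFlowFrameU L₁ M₂ β U μ (nScales β + 1))).eval (latticeMomentum L₂ k.2) /
              (β * (L₂ : ℝ) ^ 2) : ℝ) : ℂ))⁻¹ - 1,
          fun k => (1 + uvSymbolCT L₂ M₂ β μ (klFlowFrameU L₂ M₂ β U μ (nScales β + 1)) (klScale klE0 (nScales β + 1)) (k, 0) *
            (((fsub (klFlowFrameU L₂ M₂ β U μ (nScales β + 1)) (klFlowFrameU L₁ M₂ β U μ (nScales β + 1))).eval (latticeMomentum L₂ k.2) /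
              (β * (L₂ : ℝ) ^ 2) : ℝ) : ℂ))⁻¹] : Fin 3 → FreqMomentum L₂ M₂ → ℂ) *
          sectorSubMatrix L₂ M₂ β (trivialMultiplier L₂ M₂)) (x, (((2 : Fin 3), σ), 1)) (y, (((0 : Fin 1), σ), 1))‖ ≤ Cv / imagTimeWeight β M₂)
    (hCδ : ∀ (σ : Fin 2) (y : SpaceTimeIdx L₂ M₂), ∑ x : SpaceTimeIdx L₂ M₂,
      ‖(sectorAnalysisMatrix L₂ M₂ β (![fun _ => 1,
          fun k => (1 + uvSymbolCT L₂ M₂ β μ (klFlowFrameU L₂ M₂ β U μ (nScales β + 1)) (klScale klE0 (nScales β + 1)) (k, 0) *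
            (((fsub (klFlowFrameU L₂ M₂ β U μ (nScales β + 1)) (klFlowFrameU L₁ M₂ β U μ (nScales β + 1))).eval (latticeMomentum L₂ k.2) /
              (β * (L₂ : ℝ) ^ 2) : ℝ) : ℂ))⁻¹ - 1,
          fun k => (1 + uvSymbolCT L₂ M₂ β μ (klFlowFrameU L₂ M₂ β U μ (nScales β + 1)) (klScale klE0 (nScales β + 1)) (k, 0) *
            (((fsub (klFlowFrameU L₂ M₂ β U μ (nScales β + 1)) (klFlowFrameU L₁ M₂ β U μ (nScales β + 1))).eval (latticeMomentum L₂ k.2) /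
              (β * (L₂ : ℝ) ^ 2) : ℝ) : ℂ))⁻¹] : Fin 3 → FreqMomentum L₂ M₂ → ℂ) *
          sectorSubMatrix L₂ M₂ β (trivialMultiplier L₂ M₂)) (x, (((1 : Fin 3), σ), 1)) (y, (((0 : Fin 1), σ), 1))‖ ≤ Cδ / imagTimeWeight β M₂)
    (hS : ∀ (σ : Fin 2) (y₀ : SpaceTimeIdx L₂ M₂),
      fixedTupleL1 L₂ M₂ β 1 (sectorisedKernel L₂ M₂ β (trivialMultiplier L₂ M₂)
          (klEffectiveAction L₂ M₂ β U μ (klFlowFrameU L₁ M₂ β U μ (nScales β + 1)) klE0 (nScales β + 1)) 2)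
        (![((0, σ), 0), ((0, σ), 1)] : Fin 2 → SectorLeg 1) y₀ ≤ S)
    (σ : Fin 2) :
    ∑ t₁ : ImagTimeIdx M₂, ∑ ybar : TorusSite 2 L₁,
        (‖sectorisedKernel L₂ M₂ β (trivialMultiplier L₂ M₂)
              ((klEffectiveAction L₂ M₂ β U μ (klFlowFrameU L₁ M₂ β U μ (nScales β + 1)) klE0 (nScales β + 1) -
                  counterQuadratic L₂ M₂ β (klFlowFrameU L₁ M₂ β U μ (nScales β + 1))) -
                (klEffectiveAction L₂ M₂ β U μ (klFlowFrameU L₂ M₂ β U μ (nScales β + 1)) klE0 (nScales β + 1) -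
                  counterQuadratic L₂ M₂ β (klFlowFrameU L₂ M₂ β U μ (nScales β + 1)))) 2
              (![((0, σ), 0), ((0, σ), 1)] : Fin 2 → SectorLeg 1) ![of, (t₁, of.2 + Torus.proj L₂ (Torus.cRep ybar))]‖ +
          ‖sectorisedKernel L₂ M₂ β (trivialMultiplier L₂ M₂)
              ((klEffectiveAction L₂ M₂ β U μ (klFlowFrameU L₁ M₂ β U μ (nScales β + 1)) klE0 (nScales β + 1) -
                  counterQuadratic L₂ M₂ β (klFlowFrameU L₁ M₂ β U μ (nScales β + 1))) -
                (klEffectiveAction L₂ M₂ β U μ (klFlowFrameU L₂ M₂ β U μ (nScales β + 1)) klE0 (nScales β + 1) -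
                  counterQuadratic L₂ M₂ β (klFlowFrameU L₂ M₂ β U μ (nScales β + 1)))) 2
              (![((0, σ), 0), ((0, σ), 1)] : Fin 2 → SectorLeg 1) ![of, (t₁, of.2 + -Torus.proj L₂ (Torus.cRep ybar))]‖) ≤
      2 * Xχ + 2 * ((Rδ * Cv + Cδ) * S / imagTimeWeight β M₂) := by
  -- abbreviations
  set n := nScales β + 1 with hn
  set K₁ := klFlowFrameU L₁ M₂ β U μ n with hK₁
  set K₂ := klFlowFrameU L₂ M₂ β U μ n with hK₂
  set T₁ := klEffectiveAction L₂ M₂ β U μ K₁ klE0 n with hT₁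
  set A := effAction ℂ (normalCovariance L₂ M₂ (uvSymbolCT L₂ M₂ β μ K₂ (klScale klE0 n))) (counterQuadratic L₂ M₂ β (fsub K₂ K₁)) -
    counterQuadratic L₂ M₂ β (fsub K₂ K₁) with hA
  set c : HubbardFieldIdx L₂ M₂ → ℂ := fun X => (1 + uvSymbolCT L₂ M₂ β μ K₂ (klScale klE0 n) X.1 *
    (((fsub K₂ K₁).eval (latticeMomentum L₂ X.1.1.2) / (β * (L₂ : ℝ) ^ 2) : ℝ) : ℂ))⁻¹ with hc
  set v : FreqMomentum L₂ M₂ → ℂ := fun k => (1 + uvSymbolCT L₂ M₂ β μ K₂ (klScale klE0 n) (k, 0) *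
    (((fsub K₂ K₁).eval (latticeMomentum L₂ k.2) / (β * (L₂ : ℝ) ^ 2) : ℝ) : ℂ))⁻¹ with hv
  have hcv : ∀ X, c X = v X.1.1 := fun X => dress_weight_momentum β μ K₂ K₁ (klScale klE0 n) X
  set B := ExteriorAlgebra.map (LinearMap.mulLeft ℂ c) T₁ - T₁ with hB
  have hMr : (0 : ℝ) < M₂ := Nat.cast_pos.2 (Nat.pos_of_ne_zero (NeZero.ne M₂))
  have hε : 0 < imagTimeWeight β M₂ := by unfold imagTimeWeight; positivity
  -- the conversion element at the last scale
  have hconv : (T₁ - counterQuadratic L₂ M₂ β K₁) -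
      (klEffectiveAction L₂ M₂ β U μ K₂ klE0 n - counterQuadratic L₂ M₂ β K₂) = -(A + B) := by
    rw [klEffectiveAction_sub_counterQuadratic_frame_eq_lastScale hβ U μ K₁ K₂ hZ₁]
    simp only [hA, hB, hT₁]
    abel
  -- pointwise: the norm of the kernel of `−(A + B)` is at most the sum of the norms
  have hpt : ∀ x : Fin 2 → SpaceTimeIdx L₂ M₂,
      ‖sectorisedKernel L₂ M₂ β (trivialMultiplier L₂ M₂) (-(A + B)) 2 (![((0, σ), 0), ((0, σ), 1)] : Fin 2 → SectorLeg 1) x‖ ≤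
        ‖sectorisedKernel L₂ M₂ β (trivialMultiplier L₂ M₂) A 2 (![((0, σ), 0), ((0, σ), 1)] : Fin 2 → SectorLeg 1) x‖ +
          ‖sectorisedKernel L₂ M₂ β (trivialMultiplier L₂ M₂) B 2 (![((0, σ), 0), ((0, σ), 1)] : Fin 2 → SectorLeg 1) x‖ := by
    intro x
    have h0 : sectorisedKernel L₂ M₂ β (trivialMultiplier L₂ M₂) (-(A + B)) 2 (![((0, σ), 0), ((0, σ), 1)] : Fin 2 → SectorLeg 1) x =
        -(sectorisedKernel L₂ M₂ β (trivialMultiplier L₂ M₂) A 2 (![((0, σ), 0), ((0, σ), 1)] : Fin 2 → SectorLeg 1) x +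
          sectorisedKernel L₂ M₂ β (trivialMultiplier L₂ M₂) B 2 (![((0, σ), 0), ((0, σ), 1)] : Fin 2 → SectorLeg 1) x) := by
      have h1 := sectorisedKernel_sub_apply β (trivialMultiplier L₂ M₂) (0 : HubbardGrassmann L₂ M₂) (A + B) 2
        (![((0, σ), 0), ((0, σ), 1)] : Fin 2 → SectorLeg 1) x
      rw [zero_sub, sectorisedKernel_zero] at h1
      rw [h1]
      have h2 := congrFun (congrFun (sectorisedKernel_add β (trivialMultiplier L₂ M₂) A B 2) (![((0, σ), 0), ((0, σ), 1)] : Fin 2 → SectorLeg 1)) x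
      simp only [Pi.add_apply] at h2
      rw [h2]
      simp
    rw [h0, norm_neg]
    exact norm_add_le _ _
  -- (i) the chain rows
  have hArow : ∑ x₁ : SpaceTimeIdx L₂ M₂, ‖sectorisedKernel L₂ M₂ β (trivialMultiplier L₂ M₂) A 2
      (![((0, σ), 0), ((0, σ), 1)] : Fin 2 → SectorLeg 1) ![of, x₁]‖ ≤ Xχ := by
    rw [hA, pinnedRow_two_chain_eq hβ μ K₂ K₂ K₁ (klScale klE0 n) σ of]
    exact hχ σ
  -- (ii) the dressing rows
  have hBrow : ∑ x₁ : SpaceTimeIdx L₂ M₂, ‖sectorisedKernel L₂ M₂ β (trivialMultiplier L₂ M₂) B 2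
      (![((0, σ), 0), ((0, σ), 1)] : Fin 2 → SectorLeg 1) ![of, x₁]‖ ≤ (Rδ * Cv + Cδ) * S / imagTimeWeight β M₂ := by
    rw [le_div_iff₀ hε, mul_comm]
    have h := fixedTupleL1_dress_sub_le hβ c v hcv T₁ (![((0, σ), 0), ((0, σ), 1)] : Fin 2 → SectorLeg 1) of hCv0 hCδ0 hS0
      (by simpa [hv] using hRδ σ) (fun y => by simpa [hv] using hCv σ y) (fun y => by simpa [hv] using hCδ σ y)
      (fun y₀ => by
        have hΩ : (fun i : Fin 2 => ((((0 : Fin 1), ((![((0, σ), 0), ((0, σ), 1)] : Fin 2 → SectorLeg 1) i).1.2),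
            ((![((0, σ), 0), ((0, σ), 1)] : Fin 2 → SectorLeg 1) i).2) : SectorLeg 1)) = ![((0, σ), 0), ((0, σ), 1)] := by
          funext i; fin_cases i <;> rfl
        rw [hΩ]; exact hS σ y₀)
    rw [fixedTupleL1_one_eq_sum] at h
    refine le_trans (le_of_eq ?_) h
    congr 1
    refine sum_congr rfl fun x₁ _ => ?_
    rw [hB, sectorisedKernel_sub_apply]
  -- assemble: lifted rows ≤ twice the full rows
  have hlift := sum_lifted_offsets_le_two_mul (M := M₂) hL
    (fun x => sectorisedKernel L₂ M₂ β (trivialMultiplier L₂ M₂) (-(A + B)) 2 (![((0, σ), 0), ((0, σ), 1)] : Fin 2 → SectorLeg 1) x) of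
  rw [hconv]
  refine hlift.trans ?_
  have hfull : ∑ x₁ : SpaceTimeIdx L₂ M₂, ‖sectorisedKernel L₂ M₂ β (trivialMultiplier L₂ M₂) (-(A + B)) 2
      (![((0, σ), 0), ((0, σ), 1)] : Fin 2 → SectorLeg 1) ![of, x₁]‖ ≤ Xχ + (Rδ * Cv + Cδ) * S / imagTimeWeight β M₂ := by
    refine (sum_le_sum fun x₁ _ => hpt _).trans ?_
    rw [sum_add_distrib]
    exact add_le_add hArow hBrow
  linarith

/-- **`hdualSp` AT THE VL READING SCALE FROM THE COMMON-FRAME DEFECT AND NAMED CONVERSION DATA** — `hPe_lastScale_le` composed with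
`hdualSp_point_of_commonFrame_add_conversion` (p732040): with `ε·(Pc σ + (2·Xχ + 2·(Rδ·Cv + Cδ)·S/ε)) ≤ Dd/L₁` and `ε·Pf σ ≤ Df/L₁`, the body of `hdualSp` at
`n′ = nScales β + 1` holds at the pins `(oc, of)`. [cite: BenfattoGiulianiMastropietro2006, §2.4 (2.38)] -/
theorem hdualSp_point_lastScale_of_commonFrame (hL : L₁ ≤ L₂) {β : ℝ} (hβ : 0 < β) (U μ : ℝ) (oc : SpaceTimeIdx L₁ M₂) (of : SpaceTimeIdx L₂ M₂)
    (ht : of.1 = oc.1)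
    (hZ₁ : IsUnit (effPartitionFn ℂ (normalCovariance L₂ M₂ (uvSymbolCT L₂ M₂ β μ (klFlowFrameU L₁ M₂ β U μ (nScales β + 1)) (klScale klE0 (nScales β + 1))))
      (hubbardInteraction L₂ M₂ β U + counterQuadratic L₂ M₂ β (klFlowFrameU L₁ M₂ β U μ (nScales β + 1)))))
    {Xχ Rδ Cv Cδ S : ℝ} (hCv0 : 0 ≤ Cv) (hCδ0 : 0 ≤ Cδ) (hS0 : 0 ≤ S)
    (hχ : ∀ σ : Fin 2, ∑ x₁ : SpaceTimeIdx L₂ M₂, ‖∑ k : FreqMomentum L₂ M₂,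
        ((((fsub (klFlowFrameU L₂ M₂ β U μ (nScales β + 1)) (klFlowFrameU L₁ M₂ β U μ (nScales β + 1))).eval (latticeMomentum L₂ k.2) /
                (β * (L₂ : ℝ) ^ 2) : ℝ) : ℂ) /
              (1 + uvSymbolCT L₂ M₂ β μ (klFlowFrameU L₂ M₂ β U μ (nScales β + 1)) (klScale klE0 (nScales β + 1)) (k, σ) *
                (((fsub (klFlowFrameU L₂ M₂ β U μ (nScales β + 1)) (klFlowFrameU L₁ M₂ β U μ (nScales β + 1))).eval (latticeMomentum L₂ k.2) /
                  (β * (L₂ : ℝ) ^ 2) : ℝ) : ℂ)) -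
            (((fsub (klFlowFrameU L₂ M₂ β U μ (nScales β + 1)) (klFlowFrameU L₁ M₂ β U μ (nScales β + 1))).eval (latticeMomentum L₂ k.2) /
              (β * (L₂ : ℝ) ^ 2) : ℝ) : ℂ)) * (((2 : ℕ).factorial : ℚ)⁻¹ • (1 : ℂ)) *
          (Complex.exp (((matsubaraFreq β M₂ k.1 * (imagTime β M₂ x₁.1 - imagTime β M₂ of.1) : ℝ) : ℂ) * I) * torusChar k.2 (x₁.2 - of.2))‖ ≤ Xχ)
    (hRδ : ∀ σ : Fin 2, ∑ y : SpaceTimeIdx L₂ M₂,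
      ‖(sectorAnalysisMatrix L₂ M₂ β (![fun _ => 1,
          fun k => (1 + uvSymbolCT L₂ M₂ β μ (klFlowFrameU L₂ M₂ β U μ (nScales β + 1)) (klScale klE0 (nScales β + 1)) (k, 0) *
            (((fsub (klFlowFrameU L₂ M₂ β U μ (nScales β + 1)) (klFlowFrameU L₁ M₂ β U μ (nScales β + 1))).eval (latticeMomentum L₂ k.2) /
              (β * (L₂ : ℝ) ^ 2) : ℝ) : ℂ))⁻¹ - 1,
          fun k => (1 + uvSymbolCT L₂ M₂ β μ (klFlowFrameU L₂ M₂ β U μ (nScales β + 1)) (klScale klE0 (nScales β + 1)) (k, 0) *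
            (((fsub (klFlowFrameU L₂ M₂ β U μ (nScales β + 1)) (klFlowFrameU L₁ M₂ β U μ (nScales β + 1))).eval (latticeMomentum L₂ k.2) /
              (β * (L₂ : ℝ) ^ 2) : ℝ) : ℂ))⁻¹] : Fin 3 → FreqMomentum L₂ M₂ → ℂ) *
          sectorSubMatrix L₂ M₂ β (trivialMultiplier L₂ M₂)) (of, (((1 : Fin 3), σ), 0)) (y, (((0 : Fin 1), σ), 0))‖ ≤ Rδ / imagTimeWeight β M₂)
    (hCv : ∀ (σ : Fin 2) (y : SpaceTimeIdx L₂ M₂), ∑ x : SpaceTimeIdx L₂ M₂,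
      ‖(sectorAnalysisMatrix L₂ M₂ β (![fun _ => 1,
          fun k => (1 + uvSymbolCT L₂ M₂ β μ (klFlowFrameU L₂ M₂ β U μ (nScales β + 1)) (klScale klE0 (nScales β + 1)) (k, 0) *
            (((fsub (klFlowFrameU L₂ M₂ β U μ (nScales β + 1)) (klFlowFrameU L₁ M₂ β U μ (nScales β + 1))).eval (latticeMomentum L₂ k.2) /
              (β * (L₂ : ℝ) ^ 2) : ℝ) : ℂ))⁻¹ - 1,
          fun k => (1 + uvSymbolCT L₂ M₂ β μ (klFlowFrameU L₂ M₂ β U μ (nScales β + 1)) (klScale klE0 (nScales β + 1)) (k, 0) *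
            (((fsub (klFlowFrameU L₂ M₂ β U μ (nScales β + 1)) (klFlowFrameU L₁ M₂ β U μ (nScales β + 1))).eval (latticeMomentum L₂ k.2) /
              (β * (L₂ : ℝ) ^ 2) : ℝ) : ℂ))⁻¹] : Fin 3 → FreqMomentum L₂ M₂ → ℂ) *
          sectorSubMatrix L₂ M₂ β (trivialMultiplier L₂ M₂)) (x, (((2 : Fin 3), σ), 1)) (y, (((0 : Fin 1), σ), 1))‖ ≤ Cv / imagTimeWeight β M₂)
    (hCδ : ∀ (σ : Fin 2) (y : SpaceTimeIdx L₂ M₂), ∑ x : SpaceTimeIdx L₂ M₂,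
      ‖(sectorAnalysisMatrix L₂ M₂ β (![fun _ => 1,
          fun k => (1 + uvSymbolCT L₂ M₂ β μ (klFlowFrameU L₂ M₂ β U μ (nScales β + 1)) (klScale klE0 (nScales β + 1)) (k, 0) *
            (((fsub (klFlowFrameU L₂ M₂ β U μ (nScales β + 1)) (klFlowFrameU L₁ M₂ β U μ (nScales β + 1))).eval (latticeMomentum L₂ k.2) /
              (β * (L₂ : ℝ) ^ 2) : ℝ) : ℂ))⁻¹ - 1,
          fun k => (1 + uvSymbolCT L₂ M₂ β μ (klFlowFrameU L₂ M₂ β U μ (nScales β + 1)) (klScale klE0 (nScales β + 1)) (k, 0) *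
            (((fsub (klFlowFrameU L₂ M₂ β U μ (nScales β + 1)) (klFlowFrameU L₁ M₂ β U μ (nScales β + 1))).eval (latticeMomentum L₂ k.2) /
              (β * (L₂ : ℝ) ^ 2) : ℝ) : ℂ))⁻¹] : Fin 3 → FreqMomentum L₂ M₂ → ℂ) *
          sectorSubMatrix L₂ M₂ β (trivialMultiplier L₂ M₂)) (x, (((1 : Fin 3), σ), 1)) (y, (((0 : Fin 1), σ), 1))‖ ≤ Cδ / imagTimeWeight β M₂)
    (hS : ∀ (σ : Fin 2) (y₀ : SpaceTimeIdx L₂ M₂),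
      fixedTupleL1 L₂ M₂ β 1 (sectorisedKernel L₂ M₂ β (trivialMultiplier L₂ M₂)
          (klEffectiveAction L₂ M₂ β U μ (klFlowFrameU L₁ M₂ β U μ (nScales β + 1)) klE0 (nScales β + 1)) 2)
        (![((0, σ), 0), ((0, σ), 1)] : Fin 2 → SectorLeg 1) y₀ ≤ S)
    {Pc Pf : Fin 2 → ℝ} {Dd Df : ℝ}
    (hPc : ∀ σ : Fin 2, ∑ t₁ : ImagTimeIdx M₂, ∑ ybar : TorusSite 2 L₁,
        (‖sectorisedKernel L₁ M₂ β (trivialMultiplier L₁ M₂)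
              (klEffectiveAction L₁ M₂ β U μ (klFlowFrameU L₁ M₂ β U μ (nScales β + 1)) klE0 (nScales β + 1) - counterQuadratic L₁ M₂ β (klFlowFrameU L₁ M₂ β U μ (nScales β + 1))) 2
              (![((0, σ), 0), ((0, σ), 1)] : Fin 2 → SectorLeg 1) ![oc, (t₁, oc.2 + ybar)] -
            sectorisedKernel L₂ M₂ β (trivialMultiplier L₂ M₂)
              (klEffectiveAction L₂ M₂ β U μ (klFlowFrameU L₁ M₂ β U μ (nScales β + 1)) klE0 (nScales β + 1) - counterQuadratic L₂ M₂ β (klFlowFrameU L₁ M₂ β U μ (nScales β + 1))) 2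
              (![((0, σ), 0), ((0, σ), 1)] : Fin 2 → SectorLeg 1) ![of, (t₁, of.2 + Torus.proj L₂ (Torus.cRep ybar))]‖ +
          ‖sectorisedKernel L₁ M₂ β (trivialMultiplier L₁ M₂)
              (klEffectiveAction L₁ M₂ β U μ (klFlowFrameU L₁ M₂ β U μ (nScales β + 1)) klE0 (nScales β + 1) - counterQuadratic L₁ M₂ β (klFlowFrameU L₁ M₂ β U μ (nScales β + 1))) 2
              (![((0, σ), 0), ((0, σ), 1)] : Fin 2 → SectorLeg 1) ![oc, (t₁, oc.2 + -ybar)] -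
            sectorisedKernel L₂ M₂ β (trivialMultiplier L₂ M₂)
              (klEffectiveAction L₂ M₂ β U μ (klFlowFrameU L₁ M₂ β U μ (nScales β + 1)) klE0 (nScales β + 1) - counterQuadratic L₂ M₂ β (klFlowFrameU L₁ M₂ β U μ (nScales β + 1))) 2
              (![((0, σ), 0), ((0, σ), 1)] : Fin 2 → SectorLeg 1) ![of, (t₁, of.2 + -Torus.proj L₂ (Torus.cRep ybar))]‖) ≤ Pc σ)
    (hPf : ∀ σ : Fin 2, ∑ t₁ : ImagTimeIdx M₂,
        ∑ y ∈ univ.filter (fun y : TorusSite 2 L₂ => Torus.proj L₂ (Torus.cRep (fun i => (((y i).val : ℕ) : ZMod L₁))) ≠ y),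
          (‖sectorisedKernel L₂ M₂ β (trivialMultiplier L₂ M₂)
                (klEffectiveAction L₂ M₂ β U μ (klFlowFrameU L₂ M₂ β U μ (nScales β + 1)) klE0 (nScales β + 1) - counterQuadratic L₂ M₂ β (klFlowFrameU L₂ M₂ β U μ (nScales β + 1))) 2
                (![((0, σ), 0), ((0, σ), 1)] : Fin 2 → SectorLeg 1) ![of, (t₁, of.2 + y)]‖ +
            ‖sectorisedKernel L₂ M₂ β (trivialMultiplier L₂ M₂)
                (klEffectiveAction L₂ M₂ β U μ (klFlowFrameU L₂ M₂ β U μ (nScales β + 1)) klE0 (nScales β + 1) - counterQuadratic L₂ M₂ β (klFlowFrameU L₂ M₂ β U μ (nScales β + 1))) 2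
                (![((0, σ), 0), ((0, σ), 1)] : Fin 2 → SectorLeg 1) ![of, (t₁, of.2 + -y)]‖) ≤ Pf σ)
    (hDd : ∀ σ, imagTimeWeight β M₂ * (Pc σ + (2 * Xχ + 2 * ((Rδ * Cv + Cδ) * S / imagTimeWeight β M₂))) ≤ Dd / L₁)
    (hDf : ∀ σ, imagTimeWeight β M₂ * Pf σ ≤ Df / L₁) :
    (∀ m ∈ ({omega0 M₂, (omega0 M₂).rev} : Finset (MatsubaraIdx M₂)), ∀ σ : Fin 2, imagTimeWeight β M₂ * ∑ ybar : TorusSite 2 L₁,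
        (‖(∑ t₁ : ImagTimeIdx M₂,
              sectorisedKernel L₁ M₂ β (trivialMultiplier L₁ M₂)
                  (klEffectiveAction L₁ M₂ β U μ (klFlowFrameU L₁ M₂ β U μ (nScales β + 1)) klE0 (nScales β + 1) - counterQuadratic L₁ M₂ β (klFlowFrameU L₁ M₂ β U μ (nScales β + 1))) 2
                  (![((0, σ), 0), ((0, σ), 1)] : Fin 2 → SectorLeg 1) ![oc, (t₁, oc.2 + ybar)] *
                Complex.exp (((matsubaraFreq β M₂ m * (imagTime β M₂ oc.1 - imagTime β M₂ t₁) : ℝ) : ℂ) * I)) -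
            (∑ t₁ : ImagTimeIdx M₂,
              sectorisedKernel L₂ M₂ β (trivialMultiplier L₂ M₂)
                  (klEffectiveAction L₂ M₂ β U μ (klFlowFrameU L₂ M₂ β U μ (nScales β + 1)) klE0 (nScales β + 1) - counterQuadratic L₂ M₂ β (klFlowFrameU L₂ M₂ β U μ (nScales β + 1))) 2
                  (![((0, σ), 0), ((0, σ), 1)] : Fin 2 → SectorLeg 1) ![of, (t₁, of.2 + Torus.proj L₂ (Torus.cRep ybar))] *
                Complex.exp (((matsubaraFreq β M₂ m * (imagTime β M₂ of.1 - imagTime β M₂ t₁) : ℝ) : ℂ) * I))‖ +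
          ‖(∑ t₁ : ImagTimeIdx M₂,
              sectorisedKernel L₁ M₂ β (trivialMultiplier L₁ M₂)
                  (klEffectiveAction L₁ M₂ β U μ (klFlowFrameU L₁ M₂ β U μ (nScales β + 1)) klE0 (nScales β + 1) - counterQuadratic L₁ M₂ β (klFlowFrameU L₁ M₂ β U μ (nScales β + 1))) 2
                  (![((0, σ), 0), ((0, σ), 1)] : Fin 2 → SectorLeg 1) ![oc, (t₁, oc.2 + -ybar)] *
                Complex.exp (((matsubaraFreq β M₂ m * (imagTime β M₂ oc.1 - imagTime β M₂ t₁) : ℝ) : ℂ) * I)) -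
            (∑ t₁ : ImagTimeIdx M₂,
              sectorisedKernel L₂ M₂ β (trivialMultiplier L₂ M₂)
                  (klEffectiveAction L₂ M₂ β U μ (klFlowFrameU L₂ M₂ β U μ (nScales β + 1)) klE0 (nScales β + 1) - counterQuadratic L₂ M₂ β (klFlowFrameU L₂ M₂ β U μ (nScales β + 1))) 2
                  (![((0, σ), 0), ((0, σ), 1)] : Fin 2 → SectorLeg 1) ![of, (t₁, of.2 + -Torus.proj L₂ (Torus.cRep ybar))] *
                Complex.exp (((matsubaraFreq β M₂ m * (imagTime β M₂ of.1 - imagTime β M₂ t₁) : ℝ) : ℂ) * I))‖) ≤ Dd / L₁) ∧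
    (∀ m ∈ ({omega0 M₂, (omega0 M₂).rev} : Finset (MatsubaraIdx M₂)), ∀ σ : Fin 2, imagTimeWeight β M₂ *
        ∑ y ∈ univ.filter (fun y : TorusSite 2 L₂ => Torus.proj L₂ (Torus.cRep (fun i => (((y i).val : ℕ) : ZMod L₁))) ≠ y),
          (‖(∑ t₁ : ImagTimeIdx M₂,
              sectorisedKernel L₂ M₂ β (trivialMultiplier L₂ M₂)
                  (klEffectiveAction L₂ M₂ β U μ (klFlowFrameU L₂ M₂ β U μ (nScales β + 1)) klE0 (nScales β + 1) - counterQuadratic L₂ M₂ β (klFlowFrameU L₂ M₂ β U μ (nScales β + 1))) 2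
                  (![((0, σ), 0), ((0, σ), 1)] : Fin 2 → SectorLeg 1) ![of, (t₁, of.2 + y)] *
                Complex.exp (((matsubaraFreq β M₂ m * (imagTime β M₂ of.1 - imagTime β M₂ t₁) : ℝ) : ℂ) * I))‖ +
            ‖(∑ t₁ : ImagTimeIdx M₂,
              sectorisedKernel L₂ M₂ β (trivialMultiplier L₂ M₂)
                  (klEffectiveAction L₂ M₂ β U μ (klFlowFrameU L₂ M₂ β U μ (nScales β + 1)) klE0 (nScales β + 1) - counterQuadratic L₂ M₂ β (klFlowFrameU L₂ M₂ β U μ (nScales β + 1))) 2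
                  (![((0, σ), 0), ((0, σ), 1)] : Fin 2 → SectorLeg 1) ![of, (t₁, of.2 + -y)] *
                Complex.exp (((matsubaraFreq β M₂ m * (imagTime β M₂ of.1 - imagTime β M₂ t₁) : ℝ) : ℂ) * I))‖) ≤ Df / L₁) :=
  hdualSp_point_of_commonFrame_add_conversion hβ.le U μ (nScales β + 1) oc of ht (Pe := fun _ => 2 * Xχ + 2 * ((Rδ * Cv + Cδ) * S / imagTimeWeight β M₂))
    hPc (hPe_lastScale_le hL hβ U μ of hZ₁ hCv0 hCδ0 hS0 hχ hRδ hCv hCδ hS) hPf hDd hDf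

end Summit.HubbardSuperconductivity.HubbardSuperconductivity.Theorems.TwoVolumeDefect

end
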